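import Literature.Analysis.FluidPDE.ClassicalSolution
import Literature.Analysis.FluidPDE.LerayHopf
import Literature.Analysis.FluidPDE.VectorCalculus
import Literature.Analysis.FluidPDE.Vorticity
import Literature.Analysis.FluidPDE.NSWave0
import HarnessLib

/-!
# Constantin's a-priori bound on the direction dissipation `∫∫ |ω| |∇ξ|²`

For a smooth solution `u` of the incompressible Navier–Stokes equations on `ℝ³ × [0, T)` with
viscosity `ν > 0` and no force, write `ω = curl u` for the vorticity and `ξ = ω/|ω|` for the
vorticity direction (in-tree `vorticityDirection`, junk value `0` where `ω = 0`). Where `ω ≠ 0`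
the vorticity magnitude obeys the balance
`(∂ₜ + u·∇ − νΔ)|ω| + ν |ω| |∇ξ|² = (ξ · Sξ) |ω|`, `S = ½(∇u + ∇uᵀ)`,
because `|∇ω|² = |∇|ω||² + |ω|² |∇ξ|²` (Constantin 1990, (2.6)–(2.7): dividing the enstrophy-density
balance (2.6) by `|ω|` gives `(∂ₜ + u·∇ − νΔ)|ω| ≤ |∇u| |ω| + |f|`, and "information is lost
dividing by `|ω|`" — the lost term is exactly the **direction dissipation** `ν|ω||∇ξ|²`;
Constantin 2003, §3, the display after Thm. 2, prints the balance with the term `ν|ω||∇ξ|²` kept).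
Integrating over
`ℝ³ × (0, T)` (Kato's inequality across the zero set of `ω` only helps), bounding
`∫ (ξ·Sξ)|ω| ≤ ‖∇u‖₂ ‖ω‖₂ = ‖∇u‖₂²` and using the energy inequality
`ν ∫₀ᵀ ‖∇u‖₂² ≤ ½ ‖u₀‖₂²` (Constantin 1990, (2.21)) gives the a-priori budget

`ν ∫₀ᵀ ∫_{ℝ³} |ω| |∇ξ|² dx dt ≤ ‖ω₀‖_{L¹} + (2ν)⁻¹ ‖u₀‖²_{L²}`,

space–time integrability of the direction dissipation with the scaling of the energy
(`‖ω₀‖_{L¹}` and `‖u₀‖²_{L²}` both scale like a length under the Navier–Stokes scaling).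

## What is vendored, and a correction to the printed displays

* `constantin1990_direction_dissipation_bound` — the inequality above, as a NAMED FACT
  (`def … : Prop`, D-0014), for classical solutions on `Ico 0 T` that are Leray–Hopf from a rapidly
  decaying datum (the Clay class used by the consumers), with the density written with the in-tree
  `curl`, `vorticityDirection`, `frobeniusNormSq (fderiv ℝ ξ x)`; the density vanishes where
  `ω = 0`, so the junk value of `ξ` there is never seen.
* `constantin1990_direction_dissipation_bound.unit_viscosity` — the `ν = 1` specialisation
  (proved from the fact); `….enorm_mul` — the same bound with the density rendered as
  `‖ω‖ₑ · ofReal |∇ξ|²` (proved from the fact).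

The two survey restatements by Constantin — *Near identity transformations* (2003), Thm. 2 (for a
mollified system, under `ω₀ ∈ L¹`), and the C.I.M.E. lectures (LNM 1871, 2006), §4, display after
Thm. 4.1 — print the bound as `∫₀ᵀ∫ |ω||∇ξ|² ≤ ½ ν⁻² ∫|u₀|²`, i.e. **without** the term
`ν⁻¹‖ω₀‖_{L¹}`. That term cannot be dropped: under `u₀ ↦ ε u₀` the left side is of exact order
`ε` as `ε → 0` (the solution tends to the heat flow after division by `ε`, `ξ` is invariant under
positive scalings, and the heat flow of a non-zero compactly supported divergence-free field has
non-constant vorticity direction), while `½ν⁻²‖εu₀‖²₂ = O(ε²)`. The three-line argument the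
surveys sketch ("integrating in space and using the energy dissipation") yields exactly the form
with `‖ω₀‖_{L¹}` vendored here, which is also the form consistent with the hypothesis `ω₀ ∈ L¹`
under which Constantin states it. The primary paper (Constantin 1990) works on the periodic box and
prints the mechanism ((2.6)–(2.7), (2.21)) and the `L¹`-vorticity bound (Thm. 2.1/2.2), not this
display.

## Why a named fact and not a theorem (yet)

A proof from the in-tree notions needs: identification of the classical Leray–Hopf solution with
the strong solution from Schwartz-class data (weak–strong uniqueness plus far-field regularity to
exclude blow-up escaping to spatial infinity before `T`), spatial decay of `ω(t)`, `∇ω(t)` for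
`t > 0` to integrate the transport and diffusion terms by parts, and Kato's inequality for `|ω|`;
none of this is in the tree. Size XL; recorded for a `provefact` seat.

## References

* P. Constantin, *Navier–Stokes equations and area of interfaces*, Comm. Math. Phys. 129 (1990)
  241–266, §2: (2.5)–(2.7), (2.21), Thm. 2.1, Thm. 2.2.  [Constantin1990]
* P. Constantin, *Near identity transformations for the Navier–Stokes equations*, Handbook of
  Mathematical Fluid Dynamics II (2003) 117–141 (arXiv:math/0112128), §3 Thm. 2.
  [Constantin2003NearIdentity]
* P. Constantin, *Euler equations, Navier–Stokes equations and turbulence*, in: Mathematical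
  Foundation of Turbulent Viscous Flows, LNM 1871 (2006) 1–43, §4.
  [Constantin2006EulerNSTurbulence]
* R. Dascaliuc, Z. Grujić, *Vortex stretching and criticality for the 3D NSE*, arXiv:1205.7080, §1
  (quotes the same display, attributed to Constantin 1990).
-/

noncomputable section

open MeasureTheory Set
open scoped ENNReal

namespace Literature.Analysis.FluidPDE

/-- **Constantin's a-priori direction-dissipation bound** (Constantin 1990, from (2.6)–(2.7) and
the energy inequality (2.21); restated in Constantin 2003, Thm. 2 and Constantin 2006, §4).
For `ν > 0`, `T > 0` and a classical solution `(u, p)` of the unforced Navier–Stokes equations on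
`ℝ³ × [0, T)` which is a Leray–Hopf solution from its (rapidly decaying) initial datum `u 0`,
with `ω = curl u` and `ξ = ω/|ω|`:

`ν ∫∫_{(0,T) × ℝ³} |ω| |∇ξ|² dx dt ≤ ∫ |ω(·,0)| dx + (2ν)⁻¹ ∫ |u(·,0)|² dx`

in `ℝ≥0∞` (both sides may be `∞` only through `‖ω₀‖_{L¹}`; for rapidly decaying data they are
finite). The density is `‖curl (u t) x‖ · |fderiv ℝ (vorticityDirection (curl (u t))) x|²_F`; at
points with `ω ≠ 0` the direction field is smooth nearby and this is the classical `|ω||∇ξ|²`, at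
zeros of `ω` the density is `0` (as in Constantin 2003, Thm. 2, where the integral runs over
`{|ω| > 0}`). The printed survey displays omit the `‖ω₀‖_{L¹}` term, which the argument produces
and which cannot be dropped (module docstring); this is the inequality the (2.6)–(2.7)–(2.21)
argument proves. [cite: Constantin1990, §2 eqs. (2.6)–(2.7) and (2.21)] -/
def constantin1990_direction_dissipation_bound : Prop :=
  ∀ (ν T : ℝ), 0 < ν → 0 < T →
    ∀ (u : ℝ → EuclideanSpace ℝ (Fin 3) → EuclideanSpace ℝ (Fin 3))
      (p : ℝ → EuclideanSpace ℝ (Fin 3) → ℝ),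
      IsClassicalNSSolutionOn (Set.Ico 0 T) ν 0 u p →
      IsLerayHopfOn T ν 0 (u 0) u →
      HasRapidSpatialDecay (u 0) →
      ENNReal.ofReal ν *
          (∫⁻ q in Set.Ioo 0 T ×ˢ (Set.univ : Set (EuclideanSpace ℝ (Fin 3))),
            ENNReal.ofReal (‖curl (u q.1) q.2‖ *
              frobeniusNormSq (fderiv ℝ (vorticityDirection (curl (u q.1))) q.2))) ≤
        (∫⁻ x, ‖curl (u 0) x‖ₑ) + (ENNReal.ofReal (2 * ν))⁻¹ * ∫⁻ x, ‖u 0 x‖ₑ ^ 2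

/-- The `ν = 1` normalisation of Constantin's direction-dissipation bound (the form used with the
Caffarelli–Kohn–Nirenberg convention `ν = 1`): `∫∫ |ω||∇ξ|² ≤ ‖ω₀‖_{L¹} + ½‖u₀‖²_{L²}`
(Constantin 1990, (2.6)–(2.7), (2.21)). [cite: Constantin1990, §2 eqs. (2.6)–(2.7) and (2.21)] -/
theorem constantin1990_direction_dissipation_bound.unit_viscosity
    (h : constantin1990_direction_dissipation_bound) {T : ℝ} (hT : 0 < T)
    {u : ℝ → EuclideanSpace ℝ (Fin 3) → EuclideanSpace ℝ (Fin 3)}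
    {p : ℝ → EuclideanSpace ℝ (Fin 3) → ℝ} (hns : IsClassicalNSSolutionOn (Set.Ico 0 T) 1 0 u p)
    (hlh : IsLerayHopfOn T 1 0 (u 0) u) (hdec : HasRapidSpatialDecay (u 0)) :
    (∫⁻ q in Set.Ioo 0 T ×ˢ (Set.univ : Set (EuclideanSpace ℝ (Fin 3))),
        ENNReal.ofReal (‖curl (u q.1) q.2‖ *
          frobeniusNormSq (fderiv ℝ (vorticityDirection (curl (u q.1))) q.2))) ≤
      (∫⁻ x, ‖curl (u 0) x‖ₑ) + 2⁻¹ * ∫⁻ x, ‖u 0 x‖ₑ ^ 2 := by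
  have h1 := h 1 T one_pos hT u p hns hlh hdec
  simpa only [ENNReal.ofReal_one, one_mul, mul_one, ENNReal.ofReal_ofNat] using h1

/-- Constantin's direction-dissipation bound with the density rendered as
`‖ω‖ₑ · ofReal |∇ξ|²` instead of `ofReal (‖ω‖ · |∇ξ|²)` (the two renderings agree pointwise since
`‖ω‖ ≥ 0`; this is the form in which some consumers write the direction energy)
(Constantin 1990, (2.6)–(2.7), (2.21)). [cite: Constantin1990, §2 eqs. (2.6)–(2.7) and (2.21)] -/
theorem constantin1990_direction_dissipation_bound.enorm_mul
    (h : constantin1990_direction_dissipation_bound) {ν T : ℝ} (hν : 0 < ν) (hT : 0 < T)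
    {u : ℝ → EuclideanSpace ℝ (Fin 3) → EuclideanSpace ℝ (Fin 3)}
    {p : ℝ → EuclideanSpace ℝ (Fin 3) → ℝ} (hns : IsClassicalNSSolutionOn (Set.Ico 0 T) ν 0 u p)
    (hlh : IsLerayHopfOn T ν 0 (u 0) u) (hdec : HasRapidSpatialDecay (u 0)) :
    ENNReal.ofReal ν *
        (∫⁻ q in Set.Ioo 0 T ×ˢ (Set.univ : Set (EuclideanSpace ℝ (Fin 3))),
          ‖curl (u q.1) q.2‖ₑ *
            ENNReal.ofReal (frobeniusNormSq (fderiv ℝ (vorticityDirection (curl (u q.1))) q.2))) ≤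
      (∫⁻ x, ‖curl (u 0) x‖ₑ) + (ENNReal.ofReal (2 * ν))⁻¹ * ∫⁻ x, ‖u 0 x‖ₑ ^ 2 := by
  have h1 := h ν T hν hT u p hns hlh hdec
  have hpt : ∀ q : ℝ × EuclideanSpace ℝ (Fin 3),
      ENNReal.ofReal (‖curl (u q.1) q.2‖ *
          frobeniusNormSq (fderiv ℝ (vorticityDirection (curl (u q.1))) q.2)) =
        ‖curl (u q.1) q.2‖ₑ *
          ENNReal.ofReal (frobeniusNormSq (fderiv ℝ (vorticityDirection (curl (u q.1))) q.2)) := by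
    intro q
    rw [ENNReal.ofReal_mul (norm_nonneg _), ofReal_norm]
  simpa only [hpt] using h1

end Literature.Analysis.FluidPDE
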